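import Literature.Analysis.Calculus.WhitneyEvenFunctionSeveral
import HarnessLib

/-!
# Newton's theorem for smooth symmetric functions of two variables (with parameters)

The `n = 2` instance of G. Glaeser's «théorème de Newton différentiable»: a `C^∞` map
`f : (Fin 2 → ℝ) × P → E` (values in a real Banach space `E`, parameters in a finite-dimensional
real space `P`) which is symmetric in its two real variables is a `C^∞` function of the two
elementary symmetric functions `e₁ = x₀ + x₁`, `e₂ = x₀ x₁` and the parameter:
`f (x, z) = g (e₁, e₂, z)` with `g` smooth on ALL of `(Fin 2 → ℝ) × P`.

Road: in the coordinates `s = x₀ + x₁`, `ρ = x₀ − x₁` the swap `x₀ ↔ x₁` is `ρ ↦ −ρ`, so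
★ Whitney's even-function theorem with parameters (`exists_contDiff_comp_sq_of_forall_even`,
`k = 1`, parameters `(s, z)`) gives `f = U (ρ², s, z)`, and `ρ² = e₁² − 4 e₂` is polynomial.
This is the consistency instance ∕ wall model «B9» of the cell's Glaeser-`S₃` road
(N8-census §5 (9)); it is NOT used by the `S₃` theorem itself.

Sources: G. Glaeser, *Fonctions composées différentiables*, Ann. of Math. 77 (1963), Thm. II and
the «théorème de Newton» corollary; H. Whitney, *Differentiable even functions*, Duke Math. J. 10
(1943), Thm. 1. What is NOT here: `n ≥ 3` (file `GlaeserSymmetricThree`), finite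
differentiability classes, the converse direction (trivial).
-/

set_option autoImplicit false

noncomputable section

open Function
open scoped ContDiff

namespace Literature.Analysis.Calculus

universe u

variable {P : Type u} [NormedAddCommGroup P] [NormedSpace ℝ P] [FiniteDimensional ℝ P]
  {E : Type u} [NormedAddCommGroup E] [NormedSpace ℝ E] [CompleteSpace E]

/-- **Smooth Newton theorem, two variables, with parameters.** If `f : (Fin 2 → ℝ) × P → E` is
`C^∞` and invariant under the swap of its two real variables, then
`f (x, z) = g (x₀ + x₁, x₀ x₁, z)` for a `C^∞` map `g` on all of `(Fin 2 → ℝ) × P`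
(the value of `g` at `(e, z)` is read in the slots `e 0 = e₁`, `e 1 = e₂`).
[cite: Glaeser1963Newton, Thm. II («théorème de Newton différentiable», cas n = 2)] -/
theorem exists_contDiff_comp_esymm_two_of_swap (f : (Fin 2 → ℝ) × P → E) (hf : ContDiff ℝ ∞ f)
    (hsymm : ∀ (x : Fin 2 → ℝ) (z : P), f (![x 1, x 0], z) = f (x, z)) :
    ∃ g : (Fin 2 → ℝ) × P → E, ContDiff ℝ ∞ g ∧
      ∀ (x : Fin 2 → ℝ) (z : P), f (x, z) = g (![x 0 + x 1, x 0 * x 1], z) := by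
  -- the function in the coordinates `ρ = x₀ − x₁` (variable) and `(s, z) = (x₀ + x₁, z)` (parameters)
  let F : (Fin 1 → ℝ) × (ℝ × P) → E :=
    fun p => f (![(p.2.1 + p.1 0) / 2, (p.2.1 - p.1 0) / 2], p.2.2)
  have hlin : ContDiff ℝ ∞ fun p : (Fin 1 → ℝ) × (ℝ × P) =>
      ((![(p.2.1 + p.1 0) / 2, (p.2.1 - p.1 0) / 2] : Fin 2 → ℝ), p.2.2) := by
    refine ContDiff.prodMk ?_ (contDiff_snd.comp contDiff_snd)
    refine contDiff_pi.2 fun i => ?_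
    have h0 : ContDiff ℝ ∞ fun p : (Fin 1 → ℝ) × (ℝ × P) => p.1 0 :=
      (contDiff_apply ℝ ℝ (0 : Fin 1)).comp contDiff_fst
    have hs : ContDiff ℝ ∞ fun p : (Fin 1 → ℝ) × (ℝ × P) => p.2.1 :=
      contDiff_fst.comp contDiff_snd
    fin_cases i
    · exact (hs.add h0).div_const _
    · exact (hs.sub h0).div_const _
  have hF : ContDiff ℝ ∞ F := hf.comp hlin
  have heven : ∀ (i : Fin 1) (ρ : Fin 1 → ℝ) (w : ℝ × P),
      F (update ρ i (-ρ i), w) = F (ρ, w) := by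
    intro i ρ w
    obtain rfl : i = 0 := Subsingleton.elim _ _
    have h := hsymm ![(w.1 + ρ 0) / 2, (w.1 - ρ 0) / 2] w.2
    have hv : (![(w.1 + -ρ 0) / 2, (w.1 - -ρ 0) / 2] : Fin 2 → ℝ) =
        ![![(w.1 + ρ 0) / 2, (w.1 - ρ 0) / 2] 1, ![(w.1 + ρ 0) / 2, (w.1 - ρ 0) / 2] 0] := by
      funext j
      fin_cases j
      · simp; ring
      · simp
    simp only [F, update_self]
    rw [hv, h]
  obtain ⟨U, hU, hUF, -⟩ := exists_contDiff_comp_sq_of_forall_even F hF heven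
  -- `g (e, z) = U ((e₁² − 4 e₂), e₁, z)`
  refine ⟨fun q => U (fun _ => q.1 0 ^ 2 - 4 * q.1 1, (q.1 0, q.2)), ?_, fun x z => ?_⟩
  · refine hU.comp ?_
    have h0 : ContDiff ℝ ∞ fun q : (Fin 2 → ℝ) × P => q.1 0 :=
      (contDiff_apply ℝ ℝ (0 : Fin 2)).comp contDiff_fst
    have h1 : ContDiff ℝ ∞ fun q : (Fin 2 → ℝ) × P => q.1 1 :=
      (contDiff_apply ℝ ℝ (1 : Fin 2)).comp contDiff_fst
    exact (contDiff_pi.2 fun _ => (h0.pow 2).sub (contDiff_const.mul h1)).prodMk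
      (h0.prodMk contDiff_snd)
  · have hv : x = ![(x 0 + x 1 + (x 0 - x 1)) / 2, (x 0 + x 1 - (x 0 - x 1)) / 2] := by
      funext j
      fin_cases j
      · simp
      · simp
    have hx : f (x, z) = F (fun _ => x 0 - x 1, (x 0 + x 1, z)) := by
      simp only [F]
      rw [← hv]
    rw [hx, hUF]
    simp only [Matrix.cons_val_zero, Matrix.cons_val_one]
    congr 1
    congr 1
    funext i
    ring

/-- **Smooth Newton theorem, two variables, with parameters — permutation-group form.** The
same statement with the symmetry hypothesis quantified over `Equiv.Perm (Fin 2)` (the shape of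
the `S₃` head `exists_contDiff_comp_esymm_three_of_forall_perm`).
[cite: Glaeser1963Newton, Thm. II («théorème de Newton différentiable», cas n = 2)] -/
theorem exists_contDiff_comp_esymm_two_of_forall_perm (f : (Fin 2 → ℝ) × P → E)
    (hf : ContDiff ℝ ∞ f)
    (hsymm : ∀ (σ : Equiv.Perm (Fin 2)) (x : Fin 2 → ℝ) (z : P), f (x ∘ σ, z) = f (x, z)) :
    ∃ g : (Fin 2 → ℝ) × P → E, ContDiff ℝ ∞ g ∧
      ∀ (x : Fin 2 → ℝ) (z : P), f (x, z) = g (![x 0 + x 1, x 0 * x 1], z) := by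
  refine exists_contDiff_comp_esymm_two_of_swap f hf fun x z => ?_
  have h := hsymm (Equiv.swap 0 1) x z
  have hx : (x ∘ (Equiv.swap (0 : Fin 2) 1) : Fin 2 → ℝ) = ![x 1, x 0] := by
    funext j
    fin_cases j <;> simp
  rw [hx] at h
  exact h

end Literature.Analysis.Calculus

end
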